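import Summits.QuantumFields.BalabanUV.Beta.FP.TorusCompositeObjects
import Summits.QuantumFields.BalabanUV.Beta.FP.EffFormTower
import Summits.QuantumFields.BalabanUV.Beta.FP.NestedStepLawTorusInstance
import Summits.QuantumFields.BalabanUV.Beta.FP.NestedStepLawOneShot

/-!
# `BalabanUV.Beta.FP.TorusEffFormComposite` — road «FP» for binder row D1, ROUTE T, the (j, m) torus call for `m ≥ 2` (OWNER successor d1-p3 g19's memo
# §27, ask W-FP-19-13 → leaf-05, RECORD HALF): **(EFF-m) AND (INV-m) BY ONE JOINT INDUCTION ON THE DEPTH** — for the `(n+1)`-step composite sliced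
# system of record (leaf-06 g20's `TorusCompositeObjects`: rows `compRows Lc M lev rs (n+1)` from the finest torus `towerTorus Lc M (n+1)` to the top `M`,
# fine slices `nestedSlice Lc (fine Lc M) (lev ∘ succ) (rs ∘ succ) n` = the combs of every torus STRICTLY BELOW `M`, fine form = the level-`lev (n+1)`
# bordered-Hessian form block periodised on the finest torus):
# (INV) its comb-sliced bordered matrix is non-degenerate, and (EFF) the `μμ` corner of its effective form is
# `(∏ i ∈ range (n+1), (wVH d Lc (lev i))⁻¹) •` the level-`lev 0` form block periodised on `M` — for EVERY depth `n`, by induction with the top torus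
# generalised (leaf-05 `EffFormTower` §2 tower + §3 scaling; base and step both close by leaf-05 g26's `hId_order_zero_record` and leaf-02's `torus_h1`;
# (INV) steps by the OWNER's `NestedStepLawOneShot.det_kkt_compSliced_ne_zero` at `G := 0`)

Levels are CONSECUTIVE FROM THE TOP: `hlev : ∀ i, lev i = lev (i+1) + 1` (the record takes `lev k = j + m − k`, so the constant reads
`∏_{i=0}^{m−1} (wVH d Lc (j+m−i))⁻¹ = ∏_{i=1}^{m} (wVH d Lc (j+i))⁻¹`, memo §27's `c_m`); roots `rs i ∈ box (d+1) Lc` at every level.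
Nothing of the dictionary is asserted: the objects are leaf-06's [our object] bookkeeping of the comb tower, the identities [folklore] Schur-complement
algebra at the record's index types.

HONEST DEPENDENCY (page 1, mandatory): continuum YM on T⁴ ⇐ BetaPertH ∧ nine spine estimates (0/9 proved); BetaPertH ⇐ (D1) ∧ (D4) ∧ CAP+tail;
G-an2-4 gates asym, D1 and NE2/3/4.  HONEST FRAMING (cell contract, verbatim): «discharging `BetaPertH` makes Bałaban's UV stability UNCONDITIONAL —
a real constructive-QFT result; it is NOT the continuum limit and NOT the Clay problem.»  ABSOLUTE RULE (cell charter, verbatim): «No internally-minted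
statement may enter as a cited fact. Every hypothesis is either kernel-proved in this package or a verbatim quotation of a PUBLISHED theorem with page
reference. The manuscript(s) under audit are NOT citable for their own disputed steps — they are the thing under adjudication; programme-internal
(2001/route/tribunal) claims are never citable.»  [folklore] BY NAME; no `def`, no `def … : Prop`, nothing cited, 0 sorry; 0 estimates; 0∕4 row-D1 binders;
NOT (T-ID), NOT SDF, NOT D1, NOT BetaPertH, NOT continuum, NOT Clay.  D1 formalisation swarm LEAF PROVER 05 (b2b-balaban-beta-d1-formalise-leaf-05
gen 28), 2026-08-22.  No existing file touched.
-/

noncomputable section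

open scoped BigOperators

namespace Summit.QuantumFields.BalabanUV.Beta.FP.TorusEffFormComposite

open Matrix Finset
open Literature.MathematicalPhysics.QuantumFieldTheory.Balaban1983to89
open Literature.MathematicalPhysics.QuantumFieldTheory.Balaban1983to89.Beta
open Literature.MathematicalPhysics.QuantumFieldTheory.Balaban1983to89.Beta.Composition (kkt)
open Literature.MathematicalPhysics.QuantumFieldTheory.Balaban1983to89.Beta.CompositionSingular (effForm)
open B5Prop11Plancherel (fine)
open B6Lemma24Torus (pbox)
open AffineAveraging (Site box toSite)
open OneStepResolventKernel (Fib)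
open BalabanStepJetsSucc (wVH)
open Summit.QuantumFields.BalabanUV.Beta.BorderedHessian (bhKStepAt)
open Summit.QuantumFields.BalabanUV.Beta.FP.KernelPeriodisationFib (Idx perF)
open Summit.QuantumFields.BalabanUV.Beta.FP.TorusGaugeCovarianceCoarse (coarsePt coarsePt_coe)
open Summit.QuantumFields.BalabanUV.Beta.FP.TorusCombRows (Res combRowsT)
open Summit.QuantumFields.BalabanUV.Beta.FP.TorusCompositeObjects (towerTorus Qstep combF compRows NParam nestedSlice compRows_succ compRows_one
  nestedSlice_succ nestedSlice_zero)
open Summit.QuantumFields.BalabanUV.Beta.FP.EffFormTower (effForm_nested_corner_assoc effForm_smul_form_toBlocks₁₁ det_kkt_fromRows_assoc)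
open Summit.QuantumFields.BalabanUV.Beta.FP.RelInvPeriodisedEffFormCoarse (hId_order_zero_record wVH_pos)
open Summit.QuantumFields.BalabanUV.Beta.FP.RelInvPeriodisedCoarse (det_kkt_smul_form_ne_zero_iff)
open Summit.QuantumFields.BalabanUV.Beta.FP.RelInvPeriodisedSliced (det_kkt_submatrix_equiv)
open Summit.QuantumFields.BalabanUV.Beta.FP.NestedStepLawTorusInstance (torus_h1 coarseSlot_injective coarseSlot_range)
open Summit.QuantumFields.BalabanUV.Beta.FP.NestedStepLawOneShot (det_kkt_compSliced_ne_zero)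

variable {d : ℕ} (Lc : ℕ) [NeZero Lc]

set_option synthInstance.maxSize 1024 in
/-- **[folklore] (INV-m) ∧ (EFF-m), JOINTLY, BY INDUCTION ON THE DEPTH WITH THE TOP TORUS GENERALISED.**  For every depth `n`, every top torus `M`,
every CONSECUTIVE level sequence `lev` (from the top) and every in-box root sequence `rs` — writing `𝓗(T, ℓ, r)` IN PROSE ONLY for the field-slot
block `(perF T (bhKStepAt d (toSite r) Lc ℓ)).submatrix (inl) (inl)` of the level-`ℓ` bordered-Hessian step kernel periodised on the torus `T` (spelled
out in full in the signature; no notation is declared) — the `(n+1)`-step composite sliced system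
`(𝓗(towerTorus Lc M (n+1), lev (n+1), rs (n+1)) ; [compRows Lc M lev rs (n+1); nestedSlice Lc (fine Lc M) (lev∘succ) (rs∘succ) n])`
has (i) a non-degenerate bordered matrix and (ii) effective-form corner `(∏ i ∈ range (n+1), (wVH d Lc (lev i))⁻¹) • 𝓗(M, lev 0, r′)` for ANY top root `r′`. -/
theorem torus_composite_inv_and_eff (n : ℕ) :
    ∀ (M : Fin (d + 1) → ℕ) [∀ μ, NeZero (M μ)] (lev : ℕ → ℕ) (rs : ℕ → (Fin (d + 1) → ℕ)),
      (∀ i, lev i = lev (i + 1) + 1) → (∀ i, rs i ∈ box (d + 1) Lc) →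
      (kkt ((perF (towerTorus Lc M (n + 1)) (bhKStepAt d (toSite (rs (n + 1))) Lc (lev (n + 1)))).submatrix
          (fun b : ↥(pbox (towerTorus Lc M (n + 1))) × Fin (d + 1) => ((b.1, Sum.inl b.2) : Idx (towerTorus Lc M (n + 1)) (Fib d)))
          (fun b : ↥(pbox (towerTorus Lc M (n + 1))) × Fin (d + 1) => ((b.1, Sum.inl b.2) : Idx (towerTorus Lc M (n + 1)) (Fib d))))
          (fromRows (compRows Lc M lev rs (n + 1)) (nestedSlice Lc (fine Lc M) (fun k => lev (k + 1)) (fun k => rs (k + 1)) n))).det ≠ 0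
      ∧ ∀ r' : Fin (d + 1) → ℕ,
        (effForm ((perF (towerTorus Lc M (n + 1)) (bhKStepAt d (toSite (rs (n + 1))) Lc (lev (n + 1)))).submatrix
          (fun b : ↥(pbox (towerTorus Lc M (n + 1))) × Fin (d + 1) => ((b.1, Sum.inl b.2) : Idx (towerTorus Lc M (n + 1)) (Fib d)))
          (fun b : ↥(pbox (towerTorus Lc M (n + 1))) × Fin (d + 1) => ((b.1, Sum.inl b.2) : Idx (towerTorus Lc M (n + 1)) (Fib d))))
            (fromRows (compRows Lc M lev rs (n + 1)) (nestedSlice Lc (fine Lc M) (fun k => lev (k + 1)) (fun k => rs (k + 1)) n))).toBlocks₁₁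
          = (∏ i ∈ range (n + 1), (wVH d Lc (lev i))⁻¹) • ((perF M (bhKStepAt d (toSite (r')) Lc (lev 0))).submatrix
          (fun b : ↥(pbox M) × Fin (d + 1) => ((b.1, Sum.inl b.2) : Idx M (Fib d)))
          (fun b : ↥(pbox M) × Fin (d + 1) => ((b.1, Sum.inl b.2) : Idx M (Fib d)))) := by
  induction n with
  | zero =>
    intro M _ lev rs hlev hrs
    have e1 : compRows Lc M lev rs (0 + 1) = Qstep Lc M (lev 1) (rs 1) := compRows_one Lc M lev rs
    have h01 : lev 0 = lev 1 + 1 := hlev 0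
    refine ⟨?_, fun r' => ?_⟩
    · rw [e1]
      exact torus_h1 M (hrs 1) (lev 1)
    · rw [e1, Finset.prod_range_one, h01]
      exact hId_order_zero_record M (hrs 1) (lev 1) r' (coarsePt M Lc) (coarsePt_coe M Lc) (coarseSlot_injective M) (coarseSlot_range M)
  | succ n ih =>
    intro M _ lev rs hlev hrs
    -- the tower below `M`: top torus `fine Lc M`, sequences shifted by one
    obtain ⟨ihInv, ihEff⟩ := ih (fine Lc M) (fun k => lev (k + 1)) (fun k => rs (k + 1)) (fun i => hlev (i + 1)) (fun i => hrs (i + 1))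
    have hL0 : 0 < Lc := Nat.pos_of_ne_zero (NeZero.ne Lc)
    -- the constant of the tower below, and its non-vanishing
    have hc : (∏ i ∈ range (n + 1), (wVH d Lc (lev (i + 1)))⁻¹) ≠ 0 :=
      Finset.prod_ne_zero_iff.2 fun i _ => inv_ne_zero (wVH_pos (d := d) hL0 _).ne'
    -- (EFF) of the tower below, read with the top root `rs 1`: its effective corner IS the top step's fine form, scaled
    have hE := ihEff (rs 1)
    -- the top step's fine system is non-degenerate (leaf-02 `torus_h1`), hence so is its scaled copy
    have h1top := torus_h1 M (hrs 1) (lev 1)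
    have h2 : (kkt ((effForm ((perF (towerTorus Lc (fine Lc M) (n + 1)) (bhKStepAt d (toSite (rs (n + 1 + 1))) Lc (lev (n + 1 + 1)))).submatrix
          (fun b : ↥(pbox (towerTorus Lc (fine Lc M) (n + 1))) × Fin (d + 1) => ((b.1, Sum.inl b.2) : Idx (towerTorus Lc (fine Lc M) (n + 1)) (Fib d)))
          (fun b : ↥(pbox (towerTorus Lc (fine Lc M) (n + 1))) × Fin (d + 1) => ((b.1, Sum.inl b.2) : Idx (towerTorus Lc (fine Lc M) (n + 1)) (Fib d))))
        (fromRows (compRows Lc (fine Lc M) (fun k => lev (k + 1)) (fun k => rs (k + 1)) (n + 1))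
          (nestedSlice Lc (fine Lc (fine Lc M)) (fun k => lev (k + 1 + 1)) (fun k => rs (k + 1 + 1)) n))).toBlocks₁₁)
        (fromRows (Qstep Lc M (lev 1) (rs 1)) (combF Lc (fine Lc M) (rs 1)))).det ≠ 0 := by
      rw [hE]
      exact (det_kkt_smul_form_ne_zero_iff hc _ _).2 h1top
    refine ⟨?_, fun r' => ?_⟩
    · -- (INV) at depth n+2: the OWNER's `det_kkt_compSliced_ne_zero` at `G := 0`, re-associated
      have h := det_kkt_compSliced_ne_zero _ (compRows Lc (fine Lc M) (fun k => lev (k + 1)) (fun k => rs (k + 1)) (n + 1))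
        (Qstep Lc M (lev 1) (rs 1)) 0 _ (combF Lc (fine Lc M) (rs 1)) rfl ihInv (by rw [add_zero]; exact h2)
      rw [Matrix.mul_zero, Matrix.zero_mul, add_zero, ← det_kkt_fromRows_assoc] at h
      rw [nestedSlice_succ, compRows_succ]
      exact h
    · -- (EFF) at depth n+2: tower (leaf-05 `EffFormTower`), then scaling, then the top step's `hId_order_zero_record`
      have key := effForm_nested_corner_assoc _ _ _ (Qstep Lc M (lev 1) (rs 1)) (combF Lc (fine Lc M) (rs 1))
        (isUnit_iff_ne_zero.2 ihInv) (isUnit_iff_ne_zero.2 h2)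
      rw [nestedSlice_succ, compRows_succ Lc M lev rs (n + 1)]
      -- restate the goal in the syntactic shape of the tower below (`towerTorus Lc M (n+2) = towerTorus Lc (fine Lc M) (n+1)` by `rfl`)
      show (effForm ((perF (towerTorus Lc (fine Lc M) (n + 1)) (bhKStepAt d (toSite (rs (n + 1 + 1))) Lc (lev (n + 1 + 1)))).submatrix
          (fun b : ↥(pbox (towerTorus Lc (fine Lc M) (n + 1))) × Fin (d + 1) => ((b.1, Sum.inl b.2) : Idx (towerTorus Lc (fine Lc M) (n + 1)) (Fib d)))
          (fun b : ↥(pbox (towerTorus Lc (fine Lc M) (n + 1))) × Fin (d + 1) => ((b.1, Sum.inl b.2) : Idx (towerTorus Lc (fine Lc M) (n + 1)) (Fib d))))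
          (fromRows (Qstep Lc M (lev 1) (rs 1) * compRows Lc (fine Lc M) (fun k => lev (k + 1)) (fun k => rs (k + 1)) (n + 1))
            (fromRows (combF Lc (fine Lc M) (rs 1) * compRows Lc (fine Lc M) (fun k => lev (k + 1)) (fun k => rs (k + 1)) (n + 1))
              (nestedSlice Lc (fine Lc (fine Lc M)) (fun k => lev (k + 1 + 1)) (fun k => rs (k + 1 + 1)) n)))).toBlocks₁₁
        = (∏ i ∈ range (n + 1 + 1), (wVH d Lc (lev i))⁻¹) • ((perF M (bhKStepAt d (toSite (r')) Lc (lev 0))).submatrix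
          (fun b : ↥(pbox M) × Fin (d + 1) => ((b.1, Sum.inl b.2) : Idx M (Fib d)))
          (fun b : ↥(pbox M) × Fin (d + 1) => ((b.1, Sum.inl b.2) : Idx M (Fib d))))
      rw [key, hE]
      unfold TorusCompositeObjects.Qstep TorusCompositeObjects.combF
      rw [Nat.zero_add, effForm_smul_form_toBlocks₁₁ hc _ _ _ (isUnit_iff_ne_zero.2 h1top), hId_order_zero_record M (hrs 1) (lev 1) r' (coarsePt M Lc) (coarsePt_coe M Lc) (coarseSlot_injective M) (coarseSlot_range M),
        smul_smul, ← hlev 0, Finset.prod_range_succ' _ (n + 1)]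

end Summit.QuantumFields.BalabanUV.Beta.FP.TorusEffFormComposite

end
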